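import Mathlib
import Literature.Computability.AlgebraicComplexity.RealTauKnownCases

/-!
# Tower graft line — SIMPLE ROOTS OF A PENCIL DETERMINANT: Descartes-sharp ⇒ simple ⇒ corank one ⇒ a column-deleted Gram
# determinant survives (helpers for the skew-block identity graft on Descartes-sharp block data)

Calibration helpers for the line `Cruxes/WeakLifting/Lines/tower_graft.lean` (crux `WeakLifting` = stmt-ValiantsHypothesis-19561); NO stub is
claimed; Mathlib + one tree lemma.  The mechanism files p689545 (`skewBlock_phantoms_square`, corner graft) and p702623 (`skewBlock_identity_crossings`, identity
graft) need, at every root `ρ` of `det B(t)`, ONE column `j` with `det(B″ⱼ(ρ)ᵀB″ⱼ(ρ)) ≠ 0` (`B″ⱼ` = column `j` deleted).  This file supplies it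
from ROOT COUNTING alone, so that Descartes-sharp block families whose roots are only located by sign changes can be fed to the mechanism:

* (cited, not restated) the tree's `Literature.Computability.AlgebraicComplexity.signVariations_lt_card_support` (`V(f) < #supp f`) and
  Mathlib's Descartes rule `roots_countP_pos_le_signVariations` (positive roots WITH multiplicity `≤ V(f)`) give
  `rootMultiplicity_eq_one_of_sharp` — if `#supp f ≤ Z₊(f) + 1` (Descartes-sharp: as many distinct positive roots as the monomial count allows)
  then every positive root of `f` is simple;
* `derivative_eval_ne_zero_of_rootMultiplicity_eq_one` — a simple root is not a root of `f′`;
* `derivative_det` — JACOBI, column form: `(det M)′ = Σ_c det(M with column c differentiated)` for a polynomial matrix `M`;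
* `adjugate_ne_zero_of_derivative_det` — if `(det M)′(ρ) ≠ 0` then `adj M(ρ) ≠ 0` (Cramer: each column term is `(adj M(ρ)·v)_c`);
* `exists_gram_det_ne_zero_of_adjugate_ne_zero` — `adj A ≠ 0` ⇒ some column-deleted `A″ⱼ` has `det(A″ⱼᵀA″ⱼ) ≠ 0`.

HONEST FRAMING: one-variable algebra; nothing on S4/S4b/S5/S5ᴸ, TowerB, `WeakLifting`, Conjecture B, `MatrixDescartes` (18050) or `VP ≠ VNP`.  Def-free.
Seat: prover val-sym-lift-p2 g20, `--supports stmt-ValiantsHypothesis-19561`.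
-/

-- `Summit.ValiantsHypothesis.ValiantsHypothesis.…` repeats a component by the D-0017 layout
-- (single-conjunct summit), which the `dupNamespace` linter flags; the name is mandated.
set_option linter.dupNamespace false

namespace Summit.ValiantsHypothesis.ValiantsHypothesis.Theorems.KPlusLogSqLaw.TowerGraft

open Polynomial Matrix
open scoped BigOperators Polynomial

section SimpleRoots

/-- **Descartes-sharp ⇒ simple**: if a nonzero real polynomial has (at least) as many distinct positive roots as its monomial count allows
(`#supp f ≤ Z₊(f) + 1`), then every positive root is simple. [folklore] -/
theorem rootMultiplicity_eq_one_of_sharp (f : ℝ[X]) (hf : f ≠ 0)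
    (hsharp : f.support.card ≤ (f.roots.toFinset.filter (fun t => 0 < t)).card + 1) {ρ : ℝ} (hρ : 0 < ρ) (hroot : f.IsRoot ρ) :
    f.rootMultiplicity ρ = 1 := by
  classical
  set R := f.roots.toFinset.filter (fun t => 0 < t) with hR
  -- positive roots with multiplicity ≤ V(f) ≤ #supp f − 1 ≤ #R
  have h1 : f.roots.countP (fun t => 0 < t) ≤ R.card := by
    have ha := f.roots_countP_pos_le_signVariations
    have hb := Literature.Computability.AlgebraicComplexity.signVariations_lt_card_support hf
    omega
  have h2 : f.roots.countP (fun t => 0 < t) = ∑ x ∈ R, f.roots.count x := by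
    rw [Multiset.countP_eq_card_filter, ← Multiset.toFinset_sum_count_eq, hR, Multiset.toFinset_filter]
    refine Finset.sum_congr rfl fun x hx => ?_
    rw [Multiset.count_filter_of_pos ((Finset.mem_filter.mp hx).2)]
  have hmem : ρ ∈ R := by
    simp only [hR, Finset.mem_filter, Multiset.mem_toFinset, Polynomial.mem_roots hf]
    exact ⟨hroot, hρ⟩
  have hge1 : ∀ x ∈ R, 1 ≤ f.roots.count x := fun x hx =>
    Multiset.one_le_count_iff_mem.mpr (Multiset.mem_toFinset.mp (Finset.mem_filter.mp hx).1)
  have hcnt : f.roots.count ρ = f.rootMultiplicity ρ := Polynomial.count_roots _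
  have h3 : (R.card - 1) + f.roots.count ρ ≤ ∑ x ∈ R, f.roots.count x := by
    rw [← Finset.sum_erase_add _ _ hmem]
    have : R.card - 1 ≤ ∑ x ∈ R.erase ρ, f.roots.count x := by
      calc R.card - 1 = (R.erase ρ).card := (Finset.card_erase_of_mem hmem).symm
        _ = ∑ x ∈ R.erase ρ, 1 := by simp
        _ ≤ ∑ x ∈ R.erase ρ, f.roots.count x := Finset.sum_le_sum fun x hx => hge1 x (Finset.mem_of_mem_erase hx)
    omega
  have hpos : 0 < f.rootMultiplicity ρ := (Polynomial.rootMultiplicity_pos hf).mpr hroot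
  have hc : 1 ≤ R.card := Finset.card_pos.mpr ⟨ρ, hmem⟩
  omega

/-- a simple root of `f` is not a root of `f′`. [folklore] -/
theorem derivative_eval_ne_zero_of_rootMultiplicity_eq_one (f : ℝ[X]) {ρ : ℝ} (hroot : f.IsRoot ρ)
    (h1 : f.rootMultiplicity ρ = 1) : (derivative f).eval ρ ≠ 0 := by
  have hf : f ≠ 0 := by
    rintro rfl
    simp at h1
  have hd := Polynomial.derivative_rootMultiplicity_of_root hroot
  rw [h1] at hd
  intro h0
  have hd0 : derivative f ≠ 0 := by
    intro hz
    have hdeg := Polynomial.derivative_eq_zero.mp hz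
    have hfC := Polynomial.eq_C_of_natDegree_eq_zero hdeg
    rw [hfC, Polynomial.IsRoot.def, eval_C] at hroot
    apply hf
    rw [hfC, hroot, map_zero]
  have := (Polynomial.rootMultiplicity_pos hd0).mpr h0
  omega

/-- **Jacobi's formula, column form**: the derivative of the determinant of a polynomial matrix is the sum over columns of the determinants
with that column differentiated. [folklore] -/
theorem derivative_det {n : Type*} [Fintype n] [DecidableEq n] (M : Matrix n n ℝ[X]) :
    derivative M.det = ∑ c, (M.updateCol c fun i => derivative (M i c)).det := by
  simp only [Matrix.det_apply']
  rw [derivative_sum]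
  have hterm : ∀ σ : Equiv.Perm n, derivative (((Equiv.Perm.sign σ : ℤ) : ℝ[X]) * ∏ i, M (σ i) i) =
      ∑ c, ((Equiv.Perm.sign σ : ℤ) : ℝ[X]) * ∏ i, (M.updateCol c fun i => derivative (M i c)) (σ i) i := by
    intro σ
    rw [derivative_intCast_mul, derivative_prod_finset, Finset.mul_sum]
    refine Finset.sum_congr rfl fun c _ => ?_
    congr 1
    rw [← Finset.mul_prod_erase Finset.univ _ (Finset.mem_univ c), Matrix.updateCol_self, mul_comm]
    congr 1
    refine Finset.prod_congr rfl fun i hi => ?_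
    rw [Matrix.updateCol_ne (Finset.ne_of_mem_erase hi)]
  simp only [hterm]
  rw [Finset.sum_comm]

/-- if `(det M)′(ρ) ≠ 0` then the adjugate of `M(ρ)` is not zero (each column term of Jacobi's formula at `ρ` is a coordinate of
`adj M(ρ) · v`). [folklore] -/
theorem adjugate_ne_zero_of_derivative_det {n : Type*} [Fintype n] [DecidableEq n] (M : Matrix n n ℝ[X]) (ρ : ℝ)
    (h : (derivative M.det).eval ρ ≠ 0) : (M.map (eval ρ)).adjugate ≠ 0 := by
  intro hadj
  apply h
  rw [derivative_det, eval_finsetSum]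
  refine Finset.sum_eq_zero fun c _ => ?_
  have e1 : ((M.updateCol c fun i => derivative (M i c)).det).eval ρ =
      ((M.map (eval ρ)).updateCol c fun i => (derivative (M i c)).eval ρ).det := by
    rw [← Polynomial.coe_evalRingHom, RingHom.map_det]
    congr 1
    ext i k
    simp only [RingHom.mapMatrix_apply, Matrix.map_apply, Polynomial.coe_evalRingHom]
    by_cases hk : k = c
    · subst hk
      rw [Matrix.updateCol_self, Matrix.updateCol_self]
    · rw [Matrix.updateCol_ne hk, Matrix.updateCol_ne hk, Matrix.map_apply]
  rw [e1, ← Matrix.cramer_apply, Matrix.cramer_eq_adjugate_mulVec, hadj, Matrix.zero_mulVec, Pi.zero_apply]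

/-- if `adj A ≠ 0` (square of size `q+1`) then for some column `j` the column-deleted matrix `A″ⱼ` has full column rank:
`det(A″ⱼᵀ A″ⱼ) ≠ 0`. [folklore] -/
theorem exists_gram_det_ne_zero_of_adjugate_ne_zero {q : ℕ} (A : Matrix (Fin (q + 1)) (Fin (q + 1)) ℝ) (h : A.adjugate ≠ 0) :
    ∃ j : Fin (q + 1), ((A.submatrix id j.succAbove)ᵀ * A.submatrix id j.succAbove).det ≠ 0 := by
  obtain ⟨i, j, hij⟩ : ∃ i j, A.adjugate i j ≠ 0 := by
    by_contra hc
    push Not at hc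
    exact h (Matrix.ext hc)
  rw [Matrix.adjugate_fin_succ_eq_det_submatrix] at hij
  have hminor : (A.submatrix j.succAbove i.succAbove).det ≠ 0 := fun h0 => hij (by rw [h0, mul_zero])
  refine ⟨i, ?_⟩
  have hinj : Function.Injective (A.submatrix id i.succAbove).mulVec := by
    intro v w hvw
    have hsq : (A.submatrix j.succAbove i.succAbove).mulVec v = (A.submatrix j.succAbove i.succAbove).mulVec w := by
      ext r
      have := congrFun hvw (j.succAbove r)
      simpa [Matrix.mulVec, dotProduct, Matrix.submatrix_apply] using this
    exact (Matrix.mulVec_injective_iff_isUnit.mpr ((Matrix.isUnit_iff_isUnit_det _).mpr (isUnit_iff_ne_zero.mpr hminor))) hsq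
  have hpd := Matrix.PosDef.conjTranspose_mul_self _ hinj
  rw [Matrix.conjTranspose_eq_transpose_of_trivial] at hpd
  exact hpd.det_pos.ne'

/-- **the package**: for a square polynomial matrix `M` whose determinant is Descartes-sharp (`#supp ≤ Z₊ + 1`), at every positive root `ρ`
of `det M` some column-deleted `M(ρ)″ⱼ` keeps full column rank. [this work] -/
theorem exists_gram_det_ne_zero_of_sharp {q : ℕ} (M : Matrix (Fin (q + 1)) (Fin (q + 1)) ℝ[X]) (hM : M.det ≠ 0)
    (hsharp : M.det.support.card ≤ (M.det.roots.toFinset.filter (fun t => 0 < t)).card + 1) {ρ : ℝ} (hρ : 0 < ρ)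
    (hroot : M.det.IsRoot ρ) :
    ∃ j : Fin (q + 1), (((M.map (eval ρ)).submatrix id j.succAbove)ᵀ * (M.map (eval ρ)).submatrix id j.succAbove).det ≠ 0 :=
  exists_gram_det_ne_zero_of_adjugate_ne_zero _ (adjugate_ne_zero_of_derivative_det M ρ
    (derivative_eval_ne_zero_of_rootMultiplicity_eq_one _ hroot (rootMultiplicity_eq_one_of_sharp _ hM hsharp hρ hroot)))

end SimpleRoots

end Summit.ValiantsHypothesis.ValiantsHypothesis.Theorems.KPlusLogSqLaw.TowerGraft
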